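/-
Copyright: statement-level skeleton of a published paper (lit-balaban cell, Phase-2 proof seat p37 gen 106). No claims beyond
what the kernel checks below.
-/
import Literature.MathematicalPhysics.QuantumFieldTheory.Balaban1983to89.B3GraphGlue

/-!
# B3 — T. Bałaban, *(Higgs)₂,₃ quantum fields in a finite volume. III. Renormalization*, CMP **88** (1983) 411–445
[Balaban1983Higgs3] — p. 416 [PDF 6] (1.21) `G^ε = Σ_{n=0}^∞ C₀^ε[X C₀^ε]ⁿ`: CHAINS OF TWO-LEG INSERTIONS on the concrete graph
model `B3Cor23Concrete.Graph` (p18) — a nonempty list of graphs of the model, each with a distinguished «in» and «out» external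
φ′-leg, glued consecutively (out-leg of each to the in-leg of the next by a new scalar line) is a two-leg graph of the model;
it is connected iff every piece is; with ≥ 2 pieces it is NEVER one-particle-irreducible (indeed not proper: the first glue line
separates the in-leg from the out-leg); the number of external legs is conserved at two.  This is the «chain ↦ model graph» map
that p32's `B3Eq121OnePIChains` (chains of insertions as `List ι`, resummed to (1.21) in the formal power series ring) names as
its model-side client

statement-level skeleton of published theorems with citation tags; proofs where landed; nothing here is a claim about
the Yang–Mills mass gap

PDF held: `paper:balaban1983-higgs-2-3-quantum-fields-finite-volume` (journal page = PDF page + 410); pp. 415–417 read in the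
text layer (`p0005.txt`–`p0007.txt` of `lit read`) and on the ×2 renders `run/shared/lean/pub/pub-balaban/b2b-balaban-ref1/pages/
1983-cmp88-higgs23-III/1983-cmp88-higgs23-III-p005, p006, p007-x2.png`.

CITATION HEADER (lean-in-tree rule).  lit-balaban TYPED SKELETON (HOME `run/shared/lean/pub/lit-balaban/`), PHASE 2, seat p37
gen 106 (unit `lit-balaban-p37`; TAKING lines HOME/STATUS.md 2026-08-23T10:15:46Z + FILE F addendum), last part of FILE F of
BRICK 3 of the owner r15's HQ25 programme for row **B3.Eq1.19-1.22** of `HOME/lit-balaban-r15/ROWS-B3.md` (fold owner r15,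
referee ref-4; lead g12 HEAD WORD Q25 2026-08-23T08:24:18Z: bricks WELCOME as located members, zero head weight).  Siblings (same
seat): `B3GraphGlueLegs` (legs of a juxtaposition, glued line data), `B3GraphGlue` (`glue`, `isConnected_glue_iff`,
`not_isOnePI_glue`, `not_isProper_glue`, `numExtLegs_glue`), `B3OnePIGraphs` (`IsConnected`, `IsOnePI`, `IsProper`),
`B3OnePIBridge`/`B3OnePIBridgeOrder` (the converse analysis: separating lines are bridges, totally ordered; p32 g42's
`B3OnePIChainDecomposition` carries that analysis to the pieces).  p32 g41 → p37 (2026-08-23T08:34:34Z): *"If your FILE B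
`B3OnePIChainGlue` (chain ↦ model graph) happens, my `chainAmp`/`chainDeg` on `List ι` are the natural client."*  REUSED BY NAME,
nothing re-declared.

THE PRINTED TEXT (verbatim).  p. 416: *"The function G^ε has a perturbative expansion of the following structure
G^ε = Σ_{n=0}^∞ C₀^ε[(−δm² + Σ^ε + ∂^{ε*}Σ₁^ε + Σ₁^{ε*}∂^ε + ∂^{ε*}Σ₂^ε∂^ε)C₀^ε]ⁿ, (1.21) where C₀^ε = (−Δ₀^ε + m²)^{−1} and Σ^ε, Σ₁^ε,
Σ₂^ε are given by amputated, one-particle-irreducible graphs of the expansion of G^ε."*  p. 417: *"… the summation over a family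
of one-particle-irreducible graphs with two external legs of scalar fields."*  (The n-th term: n insertions in a row, consecutive
ones joined by one C₀^ε-line; the −δm² letter is the bare vertex (1.7), which is not a graph of the model — p. 415 *"There is at
least one internal line"* — so the chains built here are chains of GRAPH insertions; print states the structure without proof.)

KIND «(ours)» (G.5-54): the constructions below are OUR plumbing ∕ dictionary on p18's model — print provenance is claimed only for the
sentences quoted above; each declaration's cite tag locates the printed notion it serves (legs (1.17) p. 415, lines ∕ chains (1.21) p. 416).
WHAT IS TYPED / PROVED (definitions with bodies + kernel theorems; no `Prop` fact, no `sorry`; standard axioms).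
§1 **`TwoLegGraph n̄`**: a graph of the model with two distinct external φ′-legs `legIn`, `legOut` (p. 417's "two external legs of
scalar fields", as a channel); **`glue2 T₁ T₂`** = `B3GraphGlue.glue` of the out-leg of `T₁` to the in-leg of `T₂`, again a
`TwoLegGraph` (in-leg of `T₁`, out-leg of `T₂` stay external: `glue_other_legL_eq_none`/`_legR_eq_none`); **`chain T l`** = the
pieces `T, l₁, …, l_r` glued consecutively (structural recursion on the list; `chain T [] = T`, `chain T (T' :: l) = glue2 T (chain T' l)`).
§2 THEOREMS: `chain_nV` (vertices add up); **`isConnected_chain_iff`** (the chain is connected iff every piece is);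
**`not_isOnePI_chain`** and **`not_isProper_chain`** for `l ≠ []` (≥ 2 pieces: the first glue line separates `legIn` from `legOut`
— a term of `[X C₀^ε]ⁿ`, n ≥ 2, is one-particle REDUCIBLE, which is why (1.21) lists only 1PI graphs inside X);
**`numExtLegs_chain`** (if every piece has exactly two external legs, so has the chain); `isOnePI_chain_iff` (a chain is 1PI iff
it has one piece and that piece is 1PI).
§3 THE DISPLAYED CASE: `pic1` = (1.22)① (p18's `g36c`) as a `TwoLegGraph`; the n = 2 term ①—C₀^ε—① of (1.21),
`chain (pic1 n̄) [pic1 n̄]`, is connected (`isConnected_chain_pic1_pic1`), NOT 1PI (`not_isOnePI_chain_pic1_pic1`), not proper, and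
has two external legs (`numExtLegs_chain_pic1_pic1`).
HONEST SCOPE.  The synthesis direction only (list of pieces ↦ glued graph and its properties); that every connected two-leg graph
IS such a chain of proper pieces (the analysis) is `B3OnePIBridge`/`B3OnePIBridgeOrder` + p32's `B3OnePIChainDecomposition`; no
amplitude (C₀^ε factors, p26's evaluator `B3GraphAmplitude`) is attached; nothing analytic.
-/

namespace Literature.MathematicalPhysics.QuantumFieldTheory.Balaban1983to89.B3OnePIChainGlue

open Relation B3Prop1 B3Cor23Concrete B3OnePIGraphs B3GraphGlueLegs B3GraphGlue

variable {nbar : ℕ}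

/-! ## §1 Two-leg insertions and their chains -/

/-- A TWO-LEG INSERTION of the model: a graph `G` with two distinct EXTERNAL legs of scalar type, the in-leg and the out-leg of
its channel (p. 417: *"graphs with two external legs of scalar fields"*; further external legs are not excluded by the structure —
`numExtLegs_chain` treats the exactly-two case). [cite: Balaban1983Higgs3, (1.21) p.416] -/
structure TwoLegGraph (nbar : ℕ) where
  /-- the underlying graph of the model -/
  G : Graph nbar
  /-- the in-leg of the channel -/
  legIn : Leg G.kind
  /-- the out-leg of the channel -/
  legOut : Leg G.kind
  /-- the in-leg is external -/
  in_ext : G.other legIn = none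
  /-- the out-leg is external -/
  out_ext : G.other legOut = none
  /-- the two legs are distinct -/
  in_ne_out : legIn ≠ legOut
  /-- the in-leg is a φ′-leg -/
  in_scalar : legIn.2.isLeft = true
  /-- the out-leg is a φ′-leg -/
  out_scalar : legOut.2.isLeft = true

/-- kernel: the out-leg of `T₁` and the in-leg of `T₂` have the same species (both φ′). [cite: Balaban1983Higgs3, (1.21) p.416] -/
theorem out_isLeft_eq_in_isLeft (T₁ T₂ : TwoLegGraph nbar) : T₁.legOut.2.isLeft = T₂.legIn.2.isLeft := by
  rw [T₁.out_scalar, T₂.in_scalar]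

/-- **Gluing two insertions in a row**: the out-leg of `T₁` is joined to the in-leg of `T₂` by a new scalar line (a C₀^ε of
(1.21)); the result is a two-leg insertion with the in-leg of `T₁` and the out-leg of `T₂`. [cite: Balaban1983Higgs3, (1.21) p.416] -/
def glue2 (T₁ T₂ : TwoLegGraph nbar) : TwoLegGraph nbar where
  G := glue T₁.G T₂.G T₁.legOut T₂.legIn T₁.out_ext T₂.in_ext (out_isLeft_eq_in_isLeft T₁ T₂)
  legIn := legL T₁.G.kind T₂.G.kind T₁.legIn
  legOut := legR T₁.G.kind T₂.G.kind T₂.legOut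
  in_ext := glue_other_legL_eq_none T₁.in_ne_out T₁.in_ext
  out_ext := glue_other_legR_eq_none (Ne.symm T₂.in_ne_out) T₂.out_ext
  in_ne_out := legL_ne_legR _ _ _ _
  in_scalar := by rw [isLeft_legL]; exact T₁.in_scalar
  out_scalar := by rw [isLeft_legR]; exact T₂.out_scalar

/-- **The chain of insertions** `T, l₁, …, l_r` glued consecutively (the graph of a term of `C₀^ε[X C₀^ε]^{r+1}` whose r + 1
letters are the given graph insertions): `chain T [] = T`, `chain T (T' :: l) = glue2 T (chain T' l)`.
[cite: Balaban1983Higgs3, (1.21) p.416] -/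
def chain : TwoLegGraph nbar → List (TwoLegGraph nbar) → TwoLegGraph nbar
  | T, [] => T
  | T, T' :: l => glue2 T (chain T' l)

/-- kernel: a one-piece chain is the piece. [cite: Balaban1983Higgs3, (1.21) p.416] -/
@[simp] theorem chain_nil (T : TwoLegGraph nbar) : chain T [] = T := rfl

/-- kernel: a longer chain is the first piece glued in front of the chain of the rest. [cite: Balaban1983Higgs3, (1.21) p.416] -/
@[simp] theorem chain_cons (T T' : TwoLegGraph nbar) (l : List (TwoLegGraph nbar)) :
    chain T (T' :: l) = glue2 T (chain T' l) := rfl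

/-! ## §2 Properties of glued insertions and chains -/

/-- kernel: the vertices of `glue2 T₁ T₂` are those of the two pieces. [cite: Balaban1983Higgs3, (1.21) p.416] -/
theorem glue2_nV (T₁ T₂ : TwoLegGraph nbar) : (glue2 T₁ T₂).G.nV = T₁.G.nV + T₂.G.nV := rfl

/-- kernel: the vertices of a chain are those of its pieces. [cite: Balaban1983Higgs3, (1.21) p.416] -/
theorem chain_nV (T : TwoLegGraph nbar) (l : List (TwoLegGraph nbar)) :
    (chain T l).G.nV = T.G.nV + (l.map fun T' => T'.G.nV).sum := by
  induction l generalizing T with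
  | nil => simp
  | cons T' l ih => simp [glue2_nV, ih]

/-- kernel: `glue2 T₁ T₂` is connected iff both pieces are. [cite: Balaban1983Higgs3, p.415] -/
theorem isConnected_glue2_iff (T₁ T₂ : TwoLegGraph nbar) :
    IsConnected (glue2 T₁ T₂).G ↔ IsConnected T₁.G ∧ IsConnected T₂.G :=
  isConnected_glue_iff (ha := T₁.out_ext) (hb := T₂.in_ext) (hab := out_isLeft_eq_in_isLeft T₁ T₂)

/-- **a chain is connected iff every piece is connected** (p. 415 *"connected in the usual sense"*).
[cite: Balaban1983Higgs3, p.415] -/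
theorem isConnected_chain_iff (T : TwoLegGraph nbar) (l : List (TwoLegGraph nbar)) :
    IsConnected (chain T l).G ↔ IsConnected T.G ∧ ∀ T' ∈ l, IsConnected T'.G := by
  induction l generalizing T with
  | nil => simp
  | cons T' l ih =>
      rw [chain_cons, isConnected_glue2_iff, ih]
      simp only [List.mem_cons, forall_eq_or_imp]

/-- kernel: a chain of connected pieces is connected. [cite: Balaban1983Higgs3, p.415] -/
theorem isConnected_chain {T : TwoLegGraph nbar} {l : List (TwoLegGraph nbar)} (hT : IsConnected T.G)
    (hl : ∀ T' ∈ l, IsConnected T'.G) : IsConnected (chain T l).G :=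
  (isConnected_chain_iff T l).2 ⟨hT, hl⟩

/-- kernel: `glue2 T₁ T₂` is one-particle reducible (the glue line separates). [cite: Balaban1983Higgs3, (1.21) p.416] -/
theorem not_isOnePI_glue2 (T₁ T₂ : TwoLegGraph nbar) : ¬ IsOnePI (glue2 T₁ T₂).G :=
  not_isOnePI_glue (ha := T₁.out_ext) (hb := T₂.in_ext) (hab := out_isLeft_eq_in_isLeft T₁ T₂)

/-- kernel: `glue2 T₁ T₂` is not proper — the glue line separates the in-leg (of `T₁`) from the out-leg (of `T₂`).
[cite: Balaban1983Higgs3, (1.21) p.416] -/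
theorem not_isProper_glue2 (T₁ T₂ : TwoLegGraph nbar) : ¬ IsProper (glue2 T₁ T₂).G :=
  not_isProper_glue (ha := T₁.out_ext) (hb := T₂.in_ext) (hab := out_isLeft_eq_in_isLeft T₁ T₂)
    T₁.in_ne_out T₁.in_ext (Ne.symm T₂.in_ne_out) T₂.out_ext

/-- **a chain with at least two pieces is never one-particle-irreducible** — the model side of: the terms of `C₀^ε[X C₀^ε]ⁿ` with
n ≥ 2 are one-particle REDUCIBLE graphs, so that (1.21) lists inside X only the 1PI graphs. [cite: Balaban1983Higgs3, (1.21) p.416] -/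
theorem not_isOnePI_chain (T : TwoLegGraph nbar) {l : List (TwoLegGraph nbar)} (hl : l ≠ []) : ¬ IsOnePI (chain T l).G := by
  obtain ⟨T', l', rfl⟩ := List.exists_cons_of_ne_nil hl
  rw [chain_cons]
  exact not_isOnePI_glue2 T (chain T' l')

/-- **… and not proper**: with ≥ 2 pieces the first glue line separates the in-leg of the chain from its out-leg.
[cite: Balaban1983Higgs3, (1.21) p.416] -/
theorem not_isProper_chain (T : TwoLegGraph nbar) {l : List (TwoLegGraph nbar)} (hl : l ≠ []) : ¬ IsProper (chain T l).G := by
  obtain ⟨T', l', rfl⟩ := List.exists_cons_of_ne_nil hl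
  rw [chain_cons]
  exact not_isProper_glue2 T (chain T' l')

/-- **a chain is 1PI iff it has exactly one piece and that piece is 1PI.** [cite: Balaban1983Higgs3, (1.21) p.416] -/
theorem isOnePI_chain_iff (T : TwoLegGraph nbar) (l : List (TwoLegGraph nbar)) :
    IsOnePI (chain T l).G ↔ l = [] ∧ IsOnePI T.G := by
  cases l with
  | nil => simp
  | cons T' l' =>
      simp only [reduceCtorEq, false_and, iff_false]
      exact not_isOnePI_chain T (List.cons_ne_nil T' l')

/-- kernel: external legs of `glue2 T₁ T₂`: all those of the pieces except the two glued ones.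
[cite: Balaban1983Higgs3, (1.21) p.416] -/
theorem numExtLegs_glue2 (T₁ T₂ : TwoLegGraph nbar) :
    (glue2 T₁ T₂).G.numExtLegs + 2 = T₁.G.numExtLegs + T₂.G.numExtLegs :=
  numExtLegs_glue (ha := T₁.out_ext) (hb := T₂.in_ext) (hab := out_isLeft_eq_in_isLeft T₁ T₂)

/-- **two-leg pieces chain to a two-leg graph**: if every piece has exactly two external legs (its in- and out-leg), so has
the chain (p. 417: the self-energy family has *"two external legs of scalar fields"*). [cite: Balaban1983Higgs3, (1.21) p.416] -/
theorem numExtLegs_chain {T : TwoLegGraph nbar} {l : List (TwoLegGraph nbar)} (hT : T.G.numExtLegs = 2)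
    (hl : ∀ T' ∈ l, T'.G.numExtLegs = 2) : (chain T l).G.numExtLegs = 2 := by
  induction l generalizing T with
  | nil => simpa using hT
  | cons T' l ih =>
      have h' := ih (hl T' (by simp)) (fun T'' hT'' => hl T'' (by simp [hT'']))
      have := numExtLegs_glue2 T (chain T' l)
      rw [chain_cons]
      omega

/-- kernel: in general the external legs of a chain are those of its pieces minus two per glue line:
`numExtLegs (chain T l) + 2·|l| = numExtLegs T + Σ numExtLegs lᵢ`. [cite: Balaban1983Higgs3, (1.21) p.416] -/
theorem numExtLegs_chain_add (T : TwoLegGraph nbar) (l : List (TwoLegGraph nbar)) :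
    (chain T l).G.numExtLegs + 2 * l.length = T.G.numExtLegs + (l.map fun T' => T'.G.numExtLegs).sum := by
  induction l generalizing T with
  | nil => simp
  | cons T' l ih =>
      have h' := ih T'
      have := numExtLegs_glue2 T (chain T' l)
      simp only [chain_cons, List.length_cons, List.map_cons, List.sum_cons]
      omega

/-- kernel: every piece keeps at least its in- and out-leg external, so a piece has ≥ 2 external legs.
[cite: Balaban1983Higgs3, (1.21) p.416] -/
theorem two_le_numExtLegs (T : TwoLegGraph nbar) : 2 ≤ T.G.numExtLegs := by
  rw [Graph.numExtLegs_eq_card]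
  have hsub : ({T.legIn, T.legOut} : Finset (Leg T.G.kind)) ⊆
      Finset.univ.filter fun x : Leg T.G.kind => T.G.other x = none := by
    intro x hx
    simp only [Finset.mem_insert, Finset.mem_singleton] at hx
    rcases hx with rfl | rfl
    · simp [T.in_ext]
    · simp [T.out_ext]
  have := Finset.card_le_card hsub
  rwa [Finset.card_pair T.in_ne_out] at this

/-- kernel: hence a chain, too, has ≥ 2 external legs (its in-leg and out-leg). [cite: Balaban1983Higgs3, (1.21) p.416] -/
theorem two_le_numExtLegs_chain (T : TwoLegGraph nbar) (l : List (TwoLegGraph nbar)) : 2 ≤ (chain T l).G.numExtLegs :=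
  two_le_numExtLegs _

/-! ## §3 The displayed case: picture ① of (1.22) as an insertion; the n = 2 term ①—① of (1.21) -/

section Picture

open B3Sect3LowestOrderGraphs

/-- **(1.22)① as a two-leg insertion**: the φ′-tadpole at the vertex (1.6) (p18's `g36c`: one vertex, φ′-legs 0—1 joined in a
loop), with channel legs φ′₂ (in) and φ′₃ (out). [cite: Balaban1983Higgs3, (1.22) p.416] -/
def pic1 (nbar : ℕ) : TwoLegGraph nbar where
  G := g36c nbar
  legIn := ⟨(0 : Fin 1), .inl ⟨2, (by decide : (2 : ℕ) < 4)⟩⟩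
  legOut := ⟨(0 : Fin 1), .inl ⟨3, (by decide : (3 : ℕ) < 4)⟩⟩
  in_ext := rfl
  out_ext := rfl
  in_ne_out := by simp
  in_scalar := rfl
  out_scalar := rfl

/-- kernel: picture ① has exactly two external legs (p18's `g36_legs` counts them by species; here p18's total count
`numExtLegs`). [cite: Balaban1983Higgs3, (3.6) p.435] -/
theorem numExtLegs_pic1 : (pic1 nbar).G.numExtLegs = 2 := by
  have h1 : (g36c nbar).intScalar (0 : Fin 1) = 2 := by rfl
  have h2 : (g36c nbar).intVector (0 : Fin 1) = 0 := by rfl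
  show (g36c nbar).numExtLegs = 2
  unfold Graph.numExtLegs Graph.extLegs
  change ∑ i : Fin 1, (((g36c nbar).kind i).scalarLegs - (g36c nbar).intScalar i +
    (((g36c nbar).kind i).vectorLegs - (g36c nbar).intVector i)) = 2
  rw [Fin.sum_univ_one, h1, h2]
  rfl

/-- **the n = 2 term ①—C₀^ε—① of (1.21)** (two tadpole insertions joined by one propagator line) is a CONNECTED graph of the
model … [cite: Balaban1983Higgs3, (1.21) p.416] -/
theorem isConnected_chain_pic1_pic1 : IsConnected (chain (pic1 nbar) [pic1 nbar]).G :=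
  isConnected_chain (B3OnePIGraphs.isOnePI_pic122_1).isConnected
    (fun T' hT' => by
      rw [List.mem_singleton] at hT'
      subst hT'
      exact (B3OnePIGraphs.isOnePI_pic122_1).isConnected)

/-- … which is one-particle REDUCIBLE (its C₀^ε-line separates the two tadpoles) — so it is a term of C₀^ε[X C₀^ε]² and not a new
1PI insertion, exactly as (1.21) organises the expansion. [cite: Balaban1983Higgs3, (1.21) p.416] -/
theorem not_isOnePI_chain_pic1_pic1 : ¬ IsOnePI (chain (pic1 nbar) [pic1 nbar]).G :=
  not_isOnePI_chain _ (List.cons_ne_nil _ _)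

/-- … not proper either (the line separates the in-leg from the out-leg) … [cite: Balaban1983Higgs3, (1.21) p.416] -/
theorem not_isProper_chain_pic1_pic1 : ¬ IsProper (chain (pic1 nbar) [pic1 nbar]).G :=
  not_isProper_chain _ (List.cons_ne_nil _ _)

/-- … and again a two-leg graph. [cite: Balaban1983Higgs3, (1.21) p.416] -/
theorem numExtLegs_chain_pic1_pic1 : (chain (pic1 nbar) [pic1 nbar]).G.numExtLegs = 2 :=
  numExtLegs_chain numExtLegs_pic1 (fun T' hT' => by
    rw [List.mem_singleton] at hT'
    subst hT'
    exact numExtLegs_pic1)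

end Picture

end Literature.MathematicalPhysics.QuantumFieldTheory.Balaban1983to89.B3OnePIChainGlue
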